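import Literature.NumberTheory.Automorphic.ShimuraCurveRibetTakahashiCokernelProofs
import Literature.NumberTheory.Automorphic.ShimuraCurveRibetTakahashiFreyDiophantineProofs
import Literature.NumberTheory.EllipticCurves.SzpiroFreyConductorProofs
import Literature.NumberTheory.DiophantineGeometry.ValuationProductEllipticManyPrimesProofs
import Literature.NumberTheory.DiophantineGeometry.AbcValuationProduct
import HarnessLib

/-!
# The Frey–Hellegouarch curve of an `abc` triple and the `(m−k)`-th-root device
# (inputs of the printed proof of Pasten's Theorem 16.7)

A *proofs* file (theorems only: no definition, no named fact) — part I of the kernel proof of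
`Literature.NumberTheory.DiophantineGeometry.pasten2024_thm_2_5` (`d(abc) ≪_ε rad(abc)^{8/3+ε}`;
H. Pasten, *Shimura curves and the abc conjecture*, J. Number Theory **254** (2024) 214–335 =
arXiv:1705.09251v4, §16.4 Theorem 16.7, p. 51 = JNT Thm 16.8) from Theorem 16.4 (ii), assembled in
`AbcValuationProductShimuraProofs.lean`. This part supplies the two elementary inputs of the printed
proof (p. 51):

* `sub_mul_log_prod_lt_of_forall_powersetCard` — **the root trick for `k`-subsets** ("we multiply
  these `m` inequalities and then we take `(m−3)`-rd roots"): if `∏_{p ∈ P∖T} v p < A ∏_{p ∈ T} p`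
  for every `k`-subset `T` of a set of primes `P` (`n = #P > k ≥ 1`), then
  `(n−k) log ∏_P v < n log A + k log ∏_P p` (double counting over ALL `k`-subsets — the print uses
  the cyclically consecutive ones; same count —, with the lemmas of the `k = 3` version
  `prod_lt_rpow_of_forall_triple` of `ValuationProductEllipticManyPrimesProofs`);
* the **Frey–Hellegouarch data of an `abc` triple** for the tree's `freyCurve a b`
  (`y² = x(x−a)(x+b)`, §3 p. 13): it is elliptic and `IsFreyHellegouarch` (Pasten's class (b.2) of
  Thm 6.1 / case (ii) of Thm 16.4), `N_E ∣ 2⁸ rad(abc)` (tree: `conductorNorm_freyCurve_dvd_holds`),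
  and at every odd prime `q`: `v_q(Δ_min) = 2 v_q(abc)` (tree:
  `factorization_minimalDiscriminantNorm_freyCurve_of_ne_two`), `q ∣ abc ⇒ q ∣ N_E`, `q² ∤ N_E` —
  the sentence "for `p > 2`, the conditions `p ∣ abc` and `p ∣ N` are equivalent, and moreover for
  such a prime `p` we have `v_p(N) = 1` and `v_p(Δ) = 2 v_p(abc)`" (p. 51) — whence the odd primes of
  `abc` are admissible building blocks (`IsABCTriple.erase_two_subset_filter`, the hypothesis of
  `pasten_cor_16_2.prod_admissible`) and `N_E ∣ 2⁹ ∏_{q ∣ abc, q odd} q`.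

## References

* [PastenShimura2024] H. Pasten, J. Number Theory 254 (2024) = arXiv:1705.09251v4 — §3 p. 13,
  proofs of Cor. 16.2 / Thm 16.5 / Thm 16.7 (pp. 49–51).
-/

noncomputable section

open Finset Real

namespace Literature.NumberTheory.DiophantineGeometry

open Literature.NumberTheory.Automorphic (IsAdmissibleFactorization IsFreyHellegouarch
  dvd_conductorNorm_of_factorization_ne_zero not_sq_dvd_conductorNorm_of_isFreyHellegouarch
  factorization_minimalDiscriminantNorm_freyCurve_of_ne_two)
open Literature.NumberTheory.EllipticCurves (freyCurve isElliptic_freyCurve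
  conductorNorm_freyCurve_dvd_holds)

/-! ### The `(m−k)`-th-root device for `k`-subsets -/

/-- **The root trick of Pasten's §16 for `k`-subsets** (logarithmic, multiplied-out form). Let `P` be
a finite set of primes, `n = #P`, `v p ≥ 1` on `P`, `1 ≤ k < n`, `A > 0`. If
`∏_{p ∈ P ∖ T} v p < A · ∏_{p ∈ T} p` for every `k`-subset `T ⊆ P`, then
`(n − k) · log ∏_{p ∈ P} v p < n · log A + k · log ∏_{p ∈ P} p`: summing the `C(n,k)` logarithmic
inequalities counts each `log v p` exactly `C(n−1,k)` times and each `log p` exactly `C(n−1,k−1)`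
times, and `C(n−1,k)·n = C(n,k)·(n−k)`, `C(n−1,k)·k = C(n−1,k−1)·(n−k)`. (The case `k = 3`,
`A = N^e` is `prod_lt_rpow_of_forall_triple`.) [cite: PastenShimura2024, proofs of Corollary 16.2, Theorem 16.5 and Theorem 16.7 (arXiv numbering, pp. 49–51)] -/
theorem sub_mul_log_prod_lt_of_forall_powersetCard {P : Finset ℕ} (hP : ∀ p ∈ P, p.Prime)
    {v : ℕ → ℕ} (hv : ∀ p ∈ P, 0 < v p) {k : ℕ} (hk : 1 ≤ k) (hkP : k < P.card) {A : ℝ}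
    (hA : 0 < A)
    (hT : ∀ T ∈ P.powersetCard k,
      ((∏ p ∈ P \ T, v p : ℕ) : ℝ) < A * ((∏ p ∈ T, p : ℕ) : ℝ)) :
    ((P.card : ℝ) - k) * Real.log ((∏ p ∈ P, v p : ℕ) : ℝ) <
      P.card * Real.log A + k * Real.log ((∏ p ∈ P, p : ℕ) : ℝ) := by
  have hlogV := log_cast_prod_eq_sum (s := P) fun p hp => (hv p hp).ne'
  have hlogN : Real.log ((∏ p ∈ P, p : ℕ) : ℝ) = ∑ p ∈ P, Real.log (p : ℝ) :=
    log_cast_prod_eq_sum (f := fun p => p) fun p hp => (hP p hp).ne_zero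
  -- Step 1: the hypothesis in logarithmic form, for each `k`-subset `T`.
  have hT' : ∀ T ∈ P.powersetCard k, ∑ p ∈ P \ T, Real.log (v p : ℝ) <
      Real.log A + ∑ p ∈ T, Real.log (p : ℝ) := by
    intro T hTm
    have hTP : T ⊆ P := (mem_powersetCard.1 hTm).1
    have hlhs : (0 : ℝ) < ((∏ p ∈ P \ T, v p : ℕ) : ℝ) := by
      exact_mod_cast prod_pos fun p hp => hv p (sdiff_subset hp)
    have hMpos : (0 : ℝ) < ((∏ p ∈ T, p : ℕ) : ℝ) := by
      exact_mod_cast prod_pos fun p hp => (hP p (hTP hp)).pos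
    have h := Real.log_lt_log hlhs (hT T hTm)
    rwa [log_cast_prod_eq_sum (s := P \ T) (fun p hp => (hv p (sdiff_subset hp)).ne'),
      Real.log_mul hA.ne' hMpos.ne',
      log_cast_prod_eq_sum (s := T) (f := fun p => p) (fun p hp => (hP p (hTP hp)).ne_zero)] at h
  -- Step 2: sum over all `k`-subsets and double count (`k = j + 1`).
  obtain ⟨j, rfl⟩ : ∃ j, k = j + 1 := ⟨k - 1, by omega⟩
  have hne : (P.powersetCard (j + 1)).Nonempty := powersetCard_nonempty.2 hkP.le
  have hsum := sum_lt_sum_of_nonempty hne hT'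
  rw [sum_powersetCard_sum_sdiff, sum_add_distrib, sum_const, card_powersetCard, nsmul_eq_mul,
    sum_powersetCard_succ_sum P j, ← hlogN, ← hlogV] at hsum
  -- hsum : C(n-1,j+1) * L < C(n,j+1) * log A + C(n-1,j) * Lp
  obtain ⟨n', hn'⟩ : ∃ n', P.card = n' + 1 := ⟨P.card - 1, by omega⟩
  rw [hn', Nat.add_sub_cancel] at hsum
  rw [hn']
  -- the binomial identities
  have id1 : ((n'.choose (j + 1) : ℕ) : ℝ) * ((n' : ℝ) + 1) =
      (((n' + 1).choose (j + 1) : ℕ) : ℝ) * ((n' : ℝ) + 1 - (j + 1)) := by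
    have h := Nat.choose_mul_succ_eq n' (j + 1)
    have hle : j + 1 ≤ n' + 1 := by omega
    have : (((n' + 1 - (j + 1) : ℕ) : ℝ)) = (n' : ℝ) + 1 - (j + 1) := by
      rw [Nat.cast_sub hle]; push_cast; ring
    rw [← this]; exact_mod_cast h
  have id2 : ((n'.choose (j + 1) : ℕ) : ℝ) * ((j : ℝ) + 1) =
      ((n'.choose j : ℕ) : ℝ) * ((n' : ℝ) + 1 - (j + 1)) := by
    have h := Nat.choose_succ_right_eq n' j
    have hle : j ≤ n' := by omega
    have : (((n' - j : ℕ) : ℝ)) = (n' : ℝ) + 1 - (j + 1) := by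
      rw [Nat.cast_sub hle]; ring
    rw [← this]; exact_mod_cast h
  have hA0pos : (0 : ℝ) < ((n'.choose (j + 1) : ℕ) : ℝ) := by
    exact_mod_cast Nat.choose_pos (by omega)
  have hnk : (0 : ℝ) < (n' : ℝ) + 1 - (j + 1) := by
    have : j + 1 < n' + 1 := by omega
    have : ((j : ℝ) + 1) < (n' : ℝ) + 1 := by exact_mod_cast this
    linarith
  set a0 : ℝ := ((n'.choose (j + 1) : ℕ) : ℝ)
  set b0 : ℝ := (((n' + 1).choose (j + 1) : ℕ) : ℝ)
  set c0 : ℝ := ((n'.choose j : ℕ) : ℝ)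
  set L : ℝ := Real.log ((∏ p ∈ P, v p : ℕ) : ℝ)
  set Lp : ℝ := Real.log ((∏ p ∈ P, p : ℕ) : ℝ)
  push_cast
  -- multiply `hsum` by `(n - k)` and use the identities
  have h2 : ((n' : ℝ) + 1 - (j + 1)) * (b0 * Real.log A + c0 * Lp) =
      a0 * (((n' : ℝ) + 1) * Real.log A + ((j : ℝ) + 1) * Lp) := by
    calc ((n' : ℝ) + 1 - (j + 1)) * (b0 * Real.log A + c0 * Lp)
        = (b0 * ((n' : ℝ) + 1 - (j + 1))) * Real.log A + (c0 * ((n' : ℝ) + 1 - (j + 1))) * Lp := by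
          ring
      _ = (a0 * ((n' : ℝ) + 1)) * Real.log A + (a0 * ((j : ℝ) + 1)) * Lp := by rw [← id1, ← id2]
      _ = a0 * (((n' : ℝ) + 1) * Real.log A + ((j : ℝ) + 1) * Lp) := by ring
  have h3 : ((n' : ℝ) + 1 - (j + 1)) * (a0 * L) <
      ((n' : ℝ) + 1 - (j + 1)) * (b0 * Real.log A + c0 * Lp) := mul_lt_mul_of_pos_left hsum hnk
  rw [h2] at h3
  have h4 : a0 * (((n' : ℝ) + 1 - (j + 1)) * L) <
      a0 * (((n' : ℝ) + 1) * Real.log A + ((j : ℝ) + 1) * Lp) := by linarith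
  exact lt_of_mul_lt_mul_left h4 hA0pos.le

/-! ### The Frey–Hellegouarch curve of an `abc` triple -/

section Frey

variable {a b c : ℕ}

/-- For an abc triple, `a · b · (a + b) ≠ 0` in `ℤ` (so `E_{a,b,c}` is an elliptic curve, §3
p. 13). [cite: PastenShimura2024, §3 p. 13] -/
theorem IsABCTriple.int_prod_ne_zero (h : IsABCTriple a b c) : (a : ℤ) * b * (a + b) ≠ 0 := by
  obtain ⟨ha, hb, -, -⟩ := h
  positivity

/-- For an abc triple, `|a · b · (a + b)| = abc` (§3 p. 13: `Δ_{E_{a,b,c}} = 2^s (abc)²`).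
[cite: PastenShimura2024, §3 p. 13] -/
theorem IsABCTriple.natAbs_int_prod (h : IsABCTriple a b c) :
    ((a : ℤ) * b * (a + b)).natAbs = a * b * c := by
  obtain ⟨-, -, habc, -⟩ := h
  rw [← habc]
  exact_mod_cast Int.natAbs_natCast (a * b * (a + b))

/-- The Frey curve `y² = x(x − a)(x + b)` of an abc triple is an elliptic curve (§3 p. 13: "the
Frey–Hellegouarch elliptic curve `E_{a,b,c}`"). [cite: PastenShimura2024, §3 p. 13] -/
theorem IsABCTriple.freyCurve_isElliptic (h : IsABCTriple a b c) :
    (freyCurve (a : ℤ) (b : ℤ)).IsElliptic :=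
  isElliptic_freyCurve h.int_prod_ne_zero

/-- The Frey curve of an abc triple is a Frey–Hellegouarch curve in the sense of Pasten §3
(tree `IsFreyHellegouarch`: `ℚ`-isomorphic — here equal — to `E_{a,b}` with `a, b ≥ 1` coprime).
[cite: PastenShimura2024, §3 p. 13] -/
theorem IsABCTriple.freyCurve_isFreyHellegouarch (h : IsABCTriple a b c) :
    IsFreyHellegouarch (freyCurve (a : ℤ) (b : ℤ)) :=
  ⟨a, b, 1, h.1, h.2.1, h.2.2.2, one_smul _ _⟩

/-- **`N_E ∣ 2⁸ · rad(abc)`** for the Frey curve of an abc triple (the tree's discharged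
`conductorNorm_freyCurve_dvd_holds`: semistable away from `2`, `f₂ ≤ 8`); in print "`N = 2^t rad(abc)`,
… `0 ≤ r ≤ 8`" (§3 p. 13, §16.4 p. 51). [cite: PastenShimura2024, §3 p. 13 and §16.4 p. 51] -/
theorem IsABCTriple.conductorNorm_freyCurve_dvd (h : IsABCTriple a b c) :
    (freyCurve (a : ℤ) (b : ℤ)).conductorNorm ℤ ∣ 2 ^ 8 * rad a b c := by
  have hab : IsCoprime (a : ℤ) (b : ℤ) := Nat.isCoprime_iff_coprime.mpr h.2.2.2
  have hd := conductorNorm_freyCurve_dvd_holds (a : ℤ) (b : ℤ) hab h.int_prod_ne_zero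
  have hrad : (UniqueFactorizationMonoid.radical ((a : ℤ) * b * (a + b))).natAbs =
      UniqueFactorizationMonoid.radical ((a : ℤ) * b * (a + b)).natAbs := by
    rw [← Int.radical_natAbs_eq_radical, Int.natAbs_natCast]
  rwa [hrad, h.natAbs_int_prod, ← rad_def] at hd

/-- **`v_q(Δ_min) = 2 · v_q(abc)` at every odd prime `q`** for the Frey curve of an abc triple
(§16.4 p. 51: "for such a prime `p` we have … `v_p(Δ) = 2 v_p(abc)`"; the tree's
`factorization_minimalDiscriminantNorm_freyCurve_of_ne_two`, Serre (4.1.9)).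
[cite: PastenShimura2024, §16.4 p. 51] -/
theorem IsABCTriple.factorization_minimalDiscriminantNorm_freyCurve (h : IsABCTriple a b c) {q : ℕ}
    (hq : q.Prime) (hq2 : q ≠ 2) :
    ((freyCurve (a : ℤ) (b : ℤ)).minimalDiscriminantNorm ℤ).factorization q =
      2 * (a * b * c).factorization q := by
  have hab : IsCoprime (a : ℤ) (b : ℤ) := Nat.isCoprime_iff_coprime.mpr h.2.2.2
  rw [factorization_minimalDiscriminantNorm_freyCurve_of_ne_two hab h.int_prod_ne_zero hq hq2,
    h.natAbs_int_prod, ← Nat.factorization_def _ hq]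

/-- **At an odd prime `q ∣ abc`, `q ∣ N_E`** for the Frey curve of an abc triple (§16.4 p. 51: "for
`p > 2`, the conditions `p ∣ abc` and `p ∣ N` are equivalent"): `v_q(Δ_min) = 2 v_q(abc) ≥ 2`, and
`N_E`, `Δ_min` have the same prime factors (`dvd_conductorNorm_of_factorization_ne_zero`).
[cite: PastenShimura2024, §16.4 p. 51] -/
theorem IsABCTriple.dvd_conductorNorm_freyCurve (h : IsABCTriple a b c) {q : ℕ} (hq : q.Prime)
    (hq2 : q ≠ 2) (hqn : q ∣ a * b * c) :
    q ∣ (freyCurve (a : ℤ) (b : ℤ)).conductorNorm ℤ := by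
  haveI := h.freyCurve_isElliptic
  refine dvd_conductorNorm_of_factorization_ne_zero _ ?_
  rw [h.factorization_minimalDiscriminantNorm_freyCurve hq hq2]
  have : 0 < (a * b * c).factorization q :=
    Nat.Prime.factorization_pos_of_dvd hq h.mul_ne_zero hqn
  omega

/-- **At an odd prime, `q² ∤ N_E`** (the Frey curve is semi-stable away from `2`; §3 p. 13, §16.4
p. 51: "`v_p(N) = 1`"). [cite: PastenShimura2024, §16.4 p. 51] -/
theorem IsABCTriple.not_sq_dvd_conductorNorm_freyCurve (h : IsABCTriple a b c) {q : ℕ}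
    (hq : q.Prime) (hq2 : q ≠ 2) : ¬ q ^ 2 ∣ (freyCurve (a : ℤ) (b : ℤ)).conductorNorm ℤ := by
  haveI := h.freyCurve_isElliptic
  exact not_sq_dvd_conductorNorm_of_isFreyHellegouarch h.freyCurve_isFreyHellegouarch hq hq2

/-- The odd prime factors of `abc` are multiplicative primes of the Frey curve: the set
`(abc).primeFactors ∖ {2}` is contained in `{q ∣ N_E : q² ∤ N_E}` (the hypothesis of
`pasten_cor_16_2.prod_admissible`). [cite: PastenShimura2024, §16.4 p. 51] -/
theorem IsABCTriple.erase_two_subset_filter (h : IsABCTriple a b c) :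
    (a * b * c).primeFactors.erase 2 ⊆
      ((freyCurve (a : ℤ) (b : ℤ)).conductorNorm ℤ).primeFactors.filter
        (fun p => ¬ p ^ 2 ∣ (freyCurve (a : ℤ) (b : ℤ)).conductorNorm ℤ) := by
  haveI := h.freyCurve_isElliptic
  intro q hq
  rw [mem_erase, Nat.mem_primeFactors] at hq
  obtain ⟨hq2, hqp, hqn, -⟩ := hq
  rw [mem_filter, Nat.mem_primeFactors]
  exact ⟨⟨hqp, h.dvd_conductorNorm_freyCurve hqp hq2 hqn,
    ((freyCurve (a : ℤ) (b : ℤ)).conductorNorm_pos_holds).ne'⟩,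
    h.not_sq_dvd_conductorNorm_freyCurve hqp hq2⟩

/-- `rad(abc) ∣ 2 · ∏_{q ∣ abc, q odd} q`. [folklore] -/
private theorem rad_dvd_two_mul_prod_erase (a b c : ℕ) :
    rad a b c ∣ 2 * ∏ q ∈ (a * b * c).primeFactors.erase 2, q := by
  rw [rad_def, Nat.radical_eq_prod_primeFactors]
  by_cases h2 : 2 ∈ (a * b * c).primeFactors
  · rw [← mul_prod_erase _ _ h2]
  · rw [erase_eq_of_notMem h2]
    exact dvd_mul_left _ _

/-- **`N_E ∣ 2⁹ · ∏_{q ∣ abc, q odd} q`** for the Frey curve of an abc triple. [cite: PastenShimura2024, §16.4 p. 51] -/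
theorem IsABCTriple.conductorNorm_freyCurve_dvd_prod_erase (h : IsABCTriple a b c) :
    (freyCurve (a : ℤ) (b : ℤ)).conductorNorm ℤ ∣ 2 ^ 9 * ∏ q ∈ (a * b * c).primeFactors.erase 2, q :=
  h.conductorNorm_freyCurve_dvd.trans (by
    rw [show (2 : ℕ) ^ 9 = 2 ^ 8 * 2 by norm_num, mul_assoc]
    exact mul_dvd_mul_left _ (rad_dvd_two_mul_prod_erase a b c))

/-- `N_E ≤ 2⁸ · rad(abc)` (real form) for the Frey curve of an abc triple. [cite: PastenShimura2024, §16.4 p. 51 ("N ≍ rad(abc)")] -/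
theorem IsABCTriple.conductorNorm_freyCurve_le (h : IsABCTriple a b c) :
    (((freyCurve (a : ℤ) (b : ℤ)).conductorNorm ℤ : ℕ) : ℝ) ≤ 2 ^ 8 * (rad a b c : ℝ) := by
  have hR : 0 < rad a b c := by rw [rad_def]; exact Nat.radical_pos _
  exact_mod_cast Nat.le_of_dvd (by positivity) h.conductorNorm_freyCurve_dvd

end Frey

end Literature.NumberTheory.DiophantineGeometry

end
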